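import Literature.AlgebraicGeometry.Resolution.AlterationsNormalFormBlowupFormalProofs
import Literature.AlgebraicGeometry.Resolution.MonomialOrderReductionUnit
import Literature.AlgebraicGeometry.Resolution.BlowupsLocal
import HarnessLib

/-!
# [OURS · L1 W4.5(b) · EL♮(3) · NOSE, N-2 (D-frame)] BLOW-UP REGULARITY FROM AN AFFINE CHART ATLAS — generic, for an arbitrary base scheme

res-L1-w45b-nose-w2 g2 (WIDTH seat on D-0157 DOOR 1; PROPOSED BRICK N-2 (D-frame) 2026-08-28T19:51Z). OURS; NOT a statement of any manuscript ([Hironaka2017]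
is a candidate under adjudication, nothing of it is asserted); AI-written, weaker than expert review. No `sorry`; standard axioms; DEF-FREE; Literature-only imports.
`--kind proof --supports stmt-ResolutionOfSingularities-20148 --as helper`; closes nothing. Resolution of singularities in positive characteristic is NOT proved here or
anywhere in this chain (dimension 3 is Cossart–Piltant 2008/2009 in print); EL♮(3) is NOT proved by this file.

WHAT. The frame of every «the blow-up along `J` is a REGULAR scheme» certificate of the chain, stated ONCE for an ARBITRARY scheme `H` and ideal sheaf `J` (the tree had
it only in hypersurface / kill-map currency: res-L1-w45b-nose-w3 ✓ `DoubleLine.isRegular_of_isBlowup_comap_vanishingIdeal`, res-D-pv-013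
`HypersurfaceSpecimen.isRegular_of_isBlowup_comap_of_charts(_local)`, the cone specimens' `isRegular_of_isBlowup_comap`):

★ `isRegular_of_isBlowup_of_chartAtlas_local` — let `c a : Spec (A a) ⟶ H` be open immersions (an «atlas» of the support of `J`: every point of `supp J`
  lies in some `range (c a)`), on which `J` is generated by finitely or infinitely many named functions `g a : κ a → A a`
  (`J.comap (c a) = (span (range (g a)))~`); suppose `H` is regular off `supp J` and, for every chart `a` and generator `j`, the affine blow-up algebra
  `(A a)[I/g a j]` is regular AT THE PRIMES CONTAINING `g a j` (the points on the exceptional divisor). Then EVERY blow-up `π : W ⟶ H` of `J` is a regular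
  scheme. Proof: off `supp J` the stalk map is an isomorphism (Stacks 02OS, tree `IsBlowup.isIso_stalkMap_of_not_mem_support`); over a chart, the restricted
  blow-up is a blow-up of `Spec (A a)` along `(g a)~` (`IsBlowup.restrict` + `comp_iso`), whose points lie in the charts `Spec (A a)[I/g a j]` (Stacks 0804,
  tree `IsBlowup.exists_chart_of_span_range_eq`), and a point over `supp J` lies on the exceptional divisor `V(g a j)` of its chart.
★ `isRegular_of_isBlowup_of_chartAtlas` — the coarse form: charts covering ALL of `H` and the blow-up algebras regular RINGS (no hypothesis on `H` itself).
CUSTOMERS: clause (d)/(P5) of «Steiner ∈ ν2» (✓ `Steiner.noseHypPointsFirstBTriplePrime_of_unobs_of_final`'s `hfin`, through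
`LinearCentre.isRegular_reducedStrictTransform_of_blowupModel`: SIX chart packets of the reduced strict transform `St~ ⊂ Bl_P ℙ³` — three vertex charts
`Spec Cᵢ/(f₁⁽ⁱ⁾)`, three far charts `Spec k[y]/(g_c)` —, each = {open immersion, `𝓘⟨Z′⟩·𝒪 = (two coordinates)~`, two ring-level regularities of ✓ p649392's kind});
the «B‴ tail to a regular end» of the hosted specimens (S_ν(4) …).
-/

set_option linter.dupNamespace false -- mandated namespace `Summit.<Summit>.<Problem>` of this single-conjunct summit

noncomputable section

open CategoryTheory CategoryTheory.Limits AlgebraicGeometry TopologicalSpace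
open Literature.AlgebraicGeometry.Resolution
open AlgebraicGeometry.Scheme.IdealSheafData

namespace Summit.ResolutionOfSingularities.ResolutionOfSingularities.Cruxes.EquisingularLiftNat.Sections

/-- **Restriction of a blow-up over an affine chart, moved to `Spec A`.** For an open immersion `c : Spec A ⟶ H` with `J.comap c = I~` and a blow-up `π : W ⟶ H` of `J`,
the restriction of `π` over `range c`, followed by `range c ≅ Spec A`, is a blow-up of `Spec A` along `I~`. [cite: GortzWedhorn2020, Prop. 13.91] (folklore) -/
theorem isBlowup_restrict_chart {H W : Scheme.{0}} {J : H.IdealSheafData} {π : W ⟶ H} (hπ : IsBlowup π J)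
    {A : CommRingCat.{0}} (c : Spec A ⟶ H) [IsOpenImmersion c] (I : Ideal A)
    (hJ : J.comap c = ofIdealTop (I.map (Scheme.ΓSpecIso A).inv.hom)) :
    IsBlowup ((π ∣_ c.opensRange) ≫ (IsOpenImmersion.isoOfRangeEq c c.opensRange.ι (by rw [Scheme.Opens.range_ι]; rfl)).symm.hom)
      (ofIdealTop (I.map (Scheme.ΓSpecIso A).inv.hom)) := by
  set eU := IsOpenImmersion.isoOfRangeEq c c.opensRange.ι (by rw [Scheme.Opens.range_ι]; rfl) with heU'
  have heU : eU.hom ≫ c.opensRange.ι = c := IsOpenImmersion.isoOfRangeEq_hom_fac _ _ _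
  have h := (hπ.restrict c.opensRange).comp_iso eU.symm
  rw [← Scheme.IdealSheafData.comap_comp, Iso.symm_inv, heU, hJ] at h
  exact h

/-- ★ **BLOW-UP REGULARITY FROM AN AFFINE CHART ATLAS, LOCAL FORM.** `H` a scheme, `J` an ideal sheaf; open immersions `c a : Spec (A a) ⟶ H` covering the support
of `J`, with `J.comap (c a) = (span (range (g a)))~`; `H` regular off `supp J`; and for every chart `a` and generator `j`, the affine blow-up algebra
`(A a)[I/g a j]` regular at every prime containing `g a j`. Then every blow-up of `H` along `J` is a regular scheme. [cite: StacksProject, Tag 0804; Tag 02OS] (folklore) -/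
theorem isRegular_of_isBlowup_of_chartAtlas_local {H : Scheme.{0}} (J : H.IdealSheafData)
    {ι : Type} (A : ι → CommRingCat.{0}) (c : ∀ a, Spec (A a) ⟶ H) [∀ a, IsOpenImmersion (c a)]
    (hcov : ∀ h : H, h ∈ (J.support : Set H) → ∃ a, h ∈ Set.range (c a))
    {κ : ι → Type} (g : ∀ a, κ a → A a)
    (hJ : ∀ a, J.comap (c a) = ofIdealTop ((Ideal.span (Set.range (g a))).map (Scheme.ΓSpecIso (A a)).inv.hom))
    (hoff : ∀ h : H, h ∉ (J.support : Set H) → IsRegularLocalRing (H.presheaf.stalk h))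
    (hreg : ∀ (a : ι) (j : κ a) (𝔐 : Ideal (blowupAlgebra (Ideal.span (Set.range (g a))) (g a j))) [𝔐.IsPrime],
      algebraMap (A a) (blowupAlgebra (Ideal.span (Set.range (g a))) (g a j)) (g a j) ∈ 𝔐 → IsRegularLocalRing (Localization.AtPrime 𝔐)) :
    ∀ (W : Scheme.{0}) (π : W ⟶ H), IsBlowup π J → Scheme.IsRegular W := by
  classical
  intro W π hπ z
  by_cases hzs : π z ∈ (J.support : Set H)
  swap
  · -- off the centre the blow-up is a local isomorphism
    haveI := hπ.isIso_stalkMap_of_not_mem_support hzs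
    haveI := hoff (π z) hzs
    exact IsRegularLocalRing.of_ringEquiv (asIso (π.stalkMap z)).commRingCatIsoToRingEquiv
  · -- over the centre: a chart `c a ∋ π z`, the restricted blow-up is a blow-up of `Spec (A a)` along `(g a)~`
    obtain ⟨a, ha⟩ := hcov (π z) hzs
    let U : H.Opens := (c a).opensRange
    have hzU : π z ∈ U := ha
    have hρU := isBlowup_restrict_chart hπ (c a) (Ideal.span (Set.range (g a))) (hJ a)
    -- the stalk of `W` at `z` is the stalk of the open piece `π⁻¹ U` at `⟨z, _⟩`
    suffices hst : IsRegularLocalRing ((↑(π ⁻¹ᵁ U) : Scheme.{0}).presheaf.stalk ⟨z, hzU⟩) from by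
      haveI := hst
      exact IsRegularLocalRing.of_ringEquiv (asIso ((π ⁻¹ᵁ U).ι.stalkMap ⟨z, hzU⟩)).commRingCatIsoToRingEquiv.symm
    -- a chart of the blow-up at a generator through the point (Stacks 0804)
    obtain ⟨j, φ, hφ, hzφ, hφρ⟩ := IsBlowup.exists_chart_of_span_range_eq hρU (g a) rfl ⟨z, hzU⟩
    obtain ⟨w, hw⟩ := hzφ
    -- `w` lies on the exceptional divisor `V(g a j)` of its chart: its image in `Spec (A a)` is the point of `Spec (A a)` under `π z ∈ supp J`
    have hwexc : algebraMap (A a) (blowupAlgebra (Ideal.span (Set.range (g a))) (g a j)) (g a j) ∈ w.asIdeal := by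
      -- the image of `w` in `Spec (A a)` lies in the support of `(span (range (g a)))~ = J.comap (c a)`, i.e. its prime contains `span (range (g a))`
      set eU := IsOpenImmersion.isoOfRangeEq (c a) (c a).opensRange.ι (by rw [Scheme.Opens.range_ι]; rfl) with heUdef
      have heU : eU.hom ≫ (c a).opensRange.ι = c a := IsOpenImmersion.isoOfRangeEq_hom_fac _ _ _
      -- the point of `Spec (A a)` under `z`
      set y : Spec (A a) := ((π ∣_ U) ≫ eU.symm.hom) ⟨z, hzU⟩ with hydef
      have hcy : c a y = π z := by
        have h1 : (c a) y = (eU.hom ≫ (c a).opensRange.ι) y := by rw [heU]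
        rw [h1, hydef, Scheme.Hom.comp_apply, Scheme.Hom.comp_apply, Iso.symm_hom, Scheme.inv_hom_apply]
        exact morphismRestrict_base_coe π U ⟨z, hzU⟩
      have hyJ : y ∈ ((J.comap (c a)).support : Set (Spec (A a))) := by
        rw [Scheme.IdealSheafData.support_comap]
        show c a y ∈ (J.support : Set H)
        rw [hcy]; exact hzs
      rw [hJ a, Scheme.IdealSheafData.coe_support_ofIdealTop, AlgebraicGeometry.Spec_zeroLocus] at hyJ
      -- `hyJ : y ∈ zeroLocus (ΓSpecIso.inv ⁻¹' I.map ΓSpecIso.inv)`, i.e. `I ≤ y.asIdeal`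
      have hIy : Ideal.span (Set.range (g a)) ≤ y.asIdeal := fun f hf =>
        (PrimeSpectrum.mem_zeroLocus _ _).mp hyJ
          (show f ∈ (Scheme.ΓSpecIso (A a)).inv ⁻¹' _ from Ideal.mem_map_of_mem (Scheme.ΓSpecIso (A a)).inv.hom hf)
      -- `y = Spec.map (algebraMap) w` by the chart square
      have hyw : y = (Spec.map (CommRingCat.ofHom (algebraMap (A a) (blowupAlgebra (Ideal.span (Set.range (g a))) (g a j))))) w := by
        rw [hydef, ← hw, ← Scheme.Hom.comp_apply, hφρ]
      have hgj : g a j ∈ y.asIdeal := hIy (Ideal.subset_span ⟨j, rfl⟩)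
      rw [hyw] at hgj
      exact hgj
    haveI := hreg a j w.asIdeal hwexc
    by_contra hz
    rw [← hw] at hz
    exact not_isRegularLocalRing_localization_of_stalk φ w hz inferInstance

/-- ★ **BLOW-UP REGULARITY FROM AN AFFINE CHART ATLAS, COARSE FORM**: charts covering ALL of `H` and every affine blow-up algebra `(A a)[I/g a j]` a
regular RING — then every blow-up of `H` along `J` is regular (no hypothesis on `H` itself: every point of the blow-up lies in some blow-up-algebra chart,
Stacks 0804). [cite: StacksProject, Tag 0804] (folklore) -/
theorem isRegular_of_isBlowup_of_chartAtlas {H : Scheme.{0}} (J : H.IdealSheafData)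
    {ι : Type} (A : ι → CommRingCat.{0}) (c : ∀ a, Spec (A a) ⟶ H) [∀ a, IsOpenImmersion (c a)]
    (hcov : ∀ h : H, ∃ a, h ∈ Set.range (c a))
    {κ : ι → Type} (g : ∀ a, κ a → A a)
    (hJ : ∀ a, J.comap (c a) = ofIdealTop ((Ideal.span (Set.range (g a))).map (Scheme.ΓSpecIso (A a)).inv.hom))
    (hreg : ∀ (a : ι) (j : κ a), IsRegularRing (blowupAlgebra (Ideal.span (Set.range (g a))) (g a j))) :
    ∀ (W : Scheme.{0}) (π : W ⟶ H), IsBlowup π J → Scheme.IsRegular W := by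
  classical
  intro W π hπ z
  obtain ⟨a, ha⟩ := hcov (π z)
  let U : H.Opens := (c a).opensRange
  have hzU : π z ∈ U := ha
  have hρU := isBlowup_restrict_chart hπ (c a) (Ideal.span (Set.range (g a))) (hJ a)
  suffices hst : IsRegularLocalRing ((↑(π ⁻¹ᵁ U) : Scheme.{0}).presheaf.stalk ⟨z, hzU⟩) from by
    haveI := hst
    exact IsRegularLocalRing.of_ringEquiv (asIso ((π ⁻¹ᵁ U).ι.stalkMap ⟨z, hzU⟩)).commRingCatIsoToRingEquiv.symm
  obtain ⟨j, φ, hφ, hzφ, -⟩ := IsBlowup.exists_chart_of_span_range_eq hρU (g a) rfl ⟨z, hzU⟩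
  obtain ⟨w, hw⟩ := hzφ
  haveI := hreg a j
  by_contra hz
  rw [← hw] at hz
  exact not_isRegularLocalRing_localization_of_stalk φ w hz inferInstance

end Summit.ResolutionOfSingularities.ResolutionOfSingularities.Cruxes.EquisingularLiftNat.Sections

end
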